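import Mathlib.RingTheory.Support
import Mathlib.RingTheory.Regular.RegularSequence
import Mathlib.RingTheory.QuotSMulTop
import Mathlib.RingTheory.Localization.BaseChange
import Mathlib.RingTheory.Localization.AtPrime.Basic
import Mathlib.RingTheory.Spectrum.Prime.Topology
import HarnessLib

/-!
# Crux `FrobeniusLadder.FRationalResolution` (stmt-ResolutionOfSingularities-15317), line `redirect`,
# stub `stub_diagonalizableQuotientResolution` — the WEAKLY-REGULAR LOCUS of a sequence is OPEN
# (regular sequences at a point spread to a neighbourhood; Bruns–Herzog Cor. 1.1.3 territory)

For the log-regular line of the census (Kato (7.1)-type openness for the monomial charts of a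
homogeneous regular system of parameters `x₁,…,x_n` at a point of the regular chart ring `S`:
the coordinate strata `S/(x_I)` must be cut out by REGULAR SEQUENCES not only at the point `𝔔` but
on a Zariski neighbourhood of it) one needs that being a (weakly) regular sequence is an OPEN
condition on `Spec`. This file proves it in Mathlib generality:

* `isSMulRegular_localizedModule_iff` — `r` is a non-zero-divisor on `S⁻¹M` iff every `m` with
  `r m = 0` is killed by some element of `S`;
* `isSMulRegular_localizedModule_iff_notMem_support` — at a prime `𝔭`: `r` is `M_𝔭`-regular iff
  `𝔭 ∉ Supp (ker (r · : M → M))`;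
* `isOpen_setOf_isSMulRegular` — for `M` Noetherian the locus `{𝔭 | r is M_𝔭-regular}` is open;
* **`isOpen_setOf_isWeaklyRegular`** — for `R` Noetherian and `M` finite, the locus
  `{𝔭 | (r₁,…,r_m) is a weakly M_𝔭-regular sequence}` is open (induction through
  `QuotSMulTop r (R_𝔭 ⊗ M) ≅ R_𝔭 ⊗ QuotSMulTop r M`);
* `exists_nhd_isWeaklyRegular` — hence a sequence weakly regular on `M_𝔭` is weakly regular on
  `M_𝔮` for all `𝔮` in a basic open neighbourhood `D(f) ∋ 𝔭`;
* `isOpen_setOf_isWeaklyRegular_self`, `exists_nhd_isWeaklyRegular_self` — the ring case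
  `M = R`, phrased with `Localization.AtPrime 𝔭` and the images of the `rᵢ`.

Honest label: generic commutative-algebra brick (no stub closed). No definitions, no named facts,
no sorry. [folklore; cite: BrunsHerzog1998, Cor. 1.1.3 and Prop. 1.1.6 (localisation of regular
sequences)]
-/

noncomputable section

-- single-problem summit: the doubled namespace component is forced
set_option linter.dupNamespace false

open RingTheory.Sequence TensorProduct PrimeSpectrum

namespace Summit.ResolutionOfSingularities.ResolutionOfSingularities.Theorems.FRationalResolution.RegularSequenceOpenLocus

universe u v

variable {R : Type u} [CommRing R] {M : Type v} [AddCommGroup M] [Module R M]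

/-- **Non-zero-divisors on a localized module, elementwise**: `r` is `S⁻¹M`-regular iff every
`m ∈ M` with `r • m = 0` is annihilated by an element of `S`. [folklore; cite: BrunsHerzog1998, Prop. 1.1.6] -/
theorem isSMulRegular_localizedModule_iff (S : Submonoid R) (r : R) :
    IsSMulRegular (LocalizedModule S M) r ↔ ∀ m : M, r • m = 0 → ∃ u : S, u • m = 0 := by
  constructor
  · intro h m hm
    have h1 : r • LocalizedModule.mk m (1 : S) = 0 := by
      rw [LocalizedModule.smul'_mk, hm, LocalizedModule.zero_mk]
    have h2 : LocalizedModule.mk m (1 : S) = 0 := h.right_eq_zero_of_smul h1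
    rwa [IsLocalizedModule.mk_eq_mk', IsLocalizedModule.mk'_eq_zero'] at h2
  · intro h
    refine IsSMulRegular.of_right_eq_zero_of_smul fun x hx => ?_
    induction x using LocalizedModule.induction_on with
    | h m s =>
      rw [LocalizedModule.smul'_mk, IsLocalizedModule.mk_eq_mk', IsLocalizedModule.mk'_eq_zero']
        at hx
      obtain ⟨u, hu⟩ := hx
      -- `u • (r • m) = 0`, so `r • (u • m) = 0`
      have hru : r • ((u : R) • m) = 0 := by
        rw [smul_smul, mul_comm, ← smul_smul]; exact hu
      obtain ⟨u', hu'⟩ := h _ hru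
      rw [IsLocalizedModule.mk_eq_mk', IsLocalizedModule.mk'_eq_zero']
      refine ⟨u' * u, ?_⟩
      rw [Submonoid.smul_def, Submonoid.coe_mul, ← smul_smul]
      exact hu'

/-- **Pointwise criterion through the support of the `r`-torsion**: for a prime `𝔭`, `r` is a
non-zero-divisor on `M_𝔭` iff `𝔭` is not in the support of `ker (r · : M → M)`.
[folklore; cite: BrunsHerzog1998, Prop. 1.1.6] -/
theorem isSMulRegular_localizedModule_iff_notMem_support (𝔭 : PrimeSpectrum R) (r : R) :
    IsSMulRegular (LocalizedModule 𝔭.asIdeal.primeCompl M) r ↔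
      𝔭 ∉ Module.support R (LinearMap.ker (LinearMap.lsmul R M r)) := by
  rw [Module.notMem_support_iff', isSMulRegular_localizedModule_iff]
  constructor
  · rintro h ⟨m, hm⟩
    have hm0 : r • m = 0 := by simpa [LinearMap.mem_ker] using hm
    obtain ⟨u, hu⟩ := h m hm0
    exact ⟨u, u.2, Subtype.ext (by simpa [Submonoid.smul_def] using hu)⟩
  · intro h m hm
    have hmk : m ∈ LinearMap.ker (LinearMap.lsmul R M r) := by
      simpa [LinearMap.mem_ker] using hm
    obtain ⟨u, hu, hum⟩ := h ⟨m, hmk⟩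
    refine ⟨⟨u, hu⟩, ?_⟩
    have := congrArg Subtype.val hum
    simpa [Submonoid.smul_def] using this

/-- **The regular locus of one element is open**: for a Noetherian module `M` and `r ∈ R`, the set
of primes `𝔭` at which `r` is a non-zero-divisor on `M_𝔭` is open in `Spec R` (its complement is
the support of the finitely generated module `ker (r ·)`). [folklore; cite: BrunsHerzog1998, Prop. 1.1.6] -/
theorem isOpen_setOf_isSMulRegular [IsNoetherian R M] (r : R) :
    IsOpen {𝔭 : PrimeSpectrum R | IsSMulRegular (LocalizedModule 𝔭.asIdeal.primeCompl M) r} := by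
  have hset : {𝔭 : PrimeSpectrum R | IsSMulRegular (LocalizedModule 𝔭.asIdeal.primeCompl M) r} =
      (Module.support R (LinearMap.ker (LinearMap.lsmul R M r)))ᶜ := by
    ext 𝔭
    rw [Set.mem_setOf_eq, isSMulRegular_localizedModule_iff_notMem_support, Set.mem_compl_iff]
  rw [hset, Module.support_eq_zeroLocus, isOpen_compl_iff]
  exact isClosed_zeroLocus _

/-- **The weakly-regular locus of a sequence is OPEN.** For a Noetherian ring `R`, a finite
`R`-module `M` and `r₁,…,r_m ∈ R`, the set of primes `𝔭` such that `r₁,…,r_m` is a weakly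
`M_𝔭`-regular sequence is open in `Spec R`. (Induction on `m`: `(r :: rs)` is weakly regular on
`M_𝔭` iff `r` is `M_𝔭`-regular and `rs` is weakly regular on `M_𝔭/rM_𝔭 ≅ (M/rM)_𝔭`; both loci
are open.) [folklore; cite: BrunsHerzog1998, Cor. 1.1.3, Prop. 1.1.6] -/
theorem isOpen_setOf_isWeaklyRegular [IsNoetherianRing R] [Module.Finite R M] (rs : List R) :
    IsOpen {𝔭 : PrimeSpectrum R |
      IsWeaklyRegular (LocalizedModule 𝔭.asIdeal.primeCompl M) rs} := by
  -- tensor form, by induction on `rs` generalizing `M`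
  suffices h : ∀ (N : Type v) [AddCommGroup N] [Module R N] [Module.Finite R N],
      IsOpen {𝔭 : PrimeSpectrum R |
        IsWeaklyRegular (Localization 𝔭.asIdeal.primeCompl ⊗[R] N) rs} by
    have hM := h M
    have hset : {𝔭 : PrimeSpectrum R |
        IsWeaklyRegular (LocalizedModule 𝔭.asIdeal.primeCompl M) rs} =
        {𝔭 : PrimeSpectrum R |
          IsWeaklyRegular (Localization 𝔭.asIdeal.primeCompl ⊗[R] M) rs} := by
      ext 𝔭
      exact ((LocalizedModule.equivTensorProduct 𝔭.asIdeal.primeCompl M).restrictScalars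
        R).isWeaklyRegular_congr rs
    rwa [hset]
  induction rs with
  | nil =>
    intro N _ _ _
    have : {𝔭 : PrimeSpectrum R |
        IsWeaklyRegular (Localization 𝔭.asIdeal.primeCompl ⊗[R] N) ([] : List R)} = Set.univ :=
      Set.eq_univ_of_forall fun 𝔭 => IsWeaklyRegular.nil R _
    rw [this]; exact isOpen_univ
  | cons r rs ih =>
    intro N _ _ _
    have hset : {𝔭 : PrimeSpectrum R |
        IsWeaklyRegular (Localization 𝔭.asIdeal.primeCompl ⊗[R] N) (r :: rs)} =
        {𝔭 : PrimeSpectrum R | IsSMulRegular (LocalizedModule 𝔭.asIdeal.primeCompl N) r} ∩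
        {𝔭 : PrimeSpectrum R |
          IsWeaklyRegular (Localization 𝔭.asIdeal.primeCompl ⊗[R] QuotSMulTop r N) rs} := by
      ext 𝔭
      rw [Set.mem_setOf_eq, isWeaklyRegular_cons_iff, Set.mem_inter_iff, Set.mem_setOf_eq,
        Set.mem_setOf_eq]
      refine and_congr ?_ ?_
      · exact (((LocalizedModule.equivTensorProduct 𝔭.asIdeal.primeCompl N).restrictScalars
          R).isSMulRegular_congr r).symm
      · exact ((QuotSMulTop.tensorQuotSMulTopEquivQuotSMulTop r
          (Localization 𝔭.asIdeal.primeCompl) N).isWeaklyRegular_congr rs).symm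
    rw [hset]
    haveI : IsNoetherian R N := isNoetherian_of_isNoetherianRing_of_finite R N
    exact (isOpen_setOf_isSMulRegular r).inter (ih (QuotSMulTop r N))

/-- **Regular sequences spread from a point to a neighbourhood**: if `r₁,…,r_m` is weakly
`M_𝔭`-regular (`R` Noetherian, `M` finite) then there is `f ∉ 𝔭` such that it is weakly
`M_𝔮`-regular for every prime `𝔮 ∌ f`. [folklore; cite: BrunsHerzog1998, Cor. 1.1.3, Prop. 1.1.6] -/
theorem exists_nhd_isWeaklyRegular [IsNoetherianRing R] [Module.Finite R M] (rs : List R)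
    (𝔭 : PrimeSpectrum R) (h : IsWeaklyRegular (LocalizedModule 𝔭.asIdeal.primeCompl M) rs) :
    ∃ f : R, f ∉ 𝔭.asIdeal ∧ ∀ 𝔮 : PrimeSpectrum R, f ∉ 𝔮.asIdeal →
      IsWeaklyRegular (LocalizedModule 𝔮.asIdeal.primeCompl M) rs := by
  have hU := isOpen_setOf_isWeaklyRegular (M := M) rs
  obtain ⟨_, ⟨f, rfl⟩, hf𝔭, hfU⟩ :=
    PrimeSpectrum.isTopologicalBasis_basic_opens.exists_subset_of_mem_open
      (show 𝔭 ∈ {𝔭 : PrimeSpectrum R |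
        IsWeaklyRegular (LocalizedModule 𝔭.asIdeal.primeCompl M) rs} from h) hU
  refine ⟨f, (PrimeSpectrum.mem_basicOpen f 𝔭).mp hf𝔭, fun 𝔮 h𝔮 => hfU ?_⟩
  exact (PrimeSpectrum.mem_basicOpen f 𝔮).mpr h𝔮

/-! ### The ring case `M = R` -/

/-- **The weakly-regular locus of a sequence of ring elements is open**: for a Noetherian ring `R`
and `r₁,…,r_m ∈ R`, the set of primes `𝔭` such that the images of `r₁,…,r_m` form a weakly regular
sequence on the local ring `R_𝔭` is open. [folklore; cite: BrunsHerzog1998, Cor. 1.1.3] -/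
theorem isOpen_setOf_isWeaklyRegular_self [IsNoetherianRing R] (rs : List R) :
    IsOpen {𝔭 : PrimeSpectrum R | IsWeaklyRegular (Localization.AtPrime 𝔭.asIdeal)
      (rs.map (algebraMap R (Localization.AtPrime 𝔭.asIdeal)))} := by
  have hset : {𝔭 : PrimeSpectrum R | IsWeaklyRegular (Localization.AtPrime 𝔭.asIdeal)
      (rs.map (algebraMap R (Localization.AtPrime 𝔭.asIdeal)))} =
      {𝔭 : PrimeSpectrum R | IsWeaklyRegular (LocalizedModule 𝔭.asIdeal.primeCompl R) rs} := by
    ext 𝔭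
    -- `Localization.AtPrime 𝔭` IS `LocalizedModule 𝔭.primeCompl R` (Mathlib's definition)
    rw [Set.mem_setOf_eq, Set.mem_setOf_eq, isWeaklyRegular_map_algebraMap_iff]
  rw [hset]
  exact isOpen_setOf_isWeaklyRegular rs

/-- **Regular sequences in `R_𝔭` spread to a neighbourhood**: if the images of `r₁,…,r_m` form a
weakly regular sequence on `R_𝔭` (`R` Noetherian), there is `f ∉ 𝔭` such that they form a weakly
regular sequence on `R_𝔮` for every prime `𝔮 ∌ f`. [folklore; cite: BrunsHerzog1998, Cor. 1.1.3] -/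
theorem exists_nhd_isWeaklyRegular_self [IsNoetherianRing R] (rs : List R) (𝔭 : PrimeSpectrum R)
    (h : IsWeaklyRegular (Localization.AtPrime 𝔭.asIdeal)
      (rs.map (algebraMap R (Localization.AtPrime 𝔭.asIdeal)))) :
    ∃ f : R, f ∉ 𝔭.asIdeal ∧ ∀ 𝔮 : PrimeSpectrum R, f ∉ 𝔮.asIdeal →
      IsWeaklyRegular (Localization.AtPrime 𝔮.asIdeal)
        (rs.map (algebraMap R (Localization.AtPrime 𝔮.asIdeal))) := by
  have hU := isOpen_setOf_isWeaklyRegular_self (R := R) rs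
  obtain ⟨_, ⟨f, rfl⟩, hf𝔭, hfU⟩ :=
    PrimeSpectrum.isTopologicalBasis_basic_opens.exists_subset_of_mem_open
      (show 𝔭 ∈ {𝔭 : PrimeSpectrum R | IsWeaklyRegular (Localization.AtPrime 𝔭.asIdeal)
        (rs.map (algebraMap R (Localization.AtPrime 𝔭.asIdeal)))} from h) hU
  refine ⟨f, (PrimeSpectrum.mem_basicOpen f 𝔭).mp hf𝔭, fun 𝔮 h𝔮 => hfU ?_⟩
  exact (PrimeSpectrum.mem_basicOpen f 𝔮).mpr h𝔮

end Summit.ResolutionOfSingularities.ResolutionOfSingularities.Theorems.FRationalResolution.RegularSequenceOpenLocus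

end
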